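import Summits.Ventures.PackingBounds.Energy.ThreePointKernelDimFour
import HarnessLib

/-!
# The Bachoc–Vallentin three-point kernels `Q 4 7` and `Q 4 8` (codes on `S³ ⊂ ℝ⁴`), written out

Framing: lottery ticket; floor = certified bounds/negative ranges. Venture `PackingBounds`, cell
`pub-packcert`, energy family E3PT (pub-packcert-energy gen 14; the `n = 4` kernel route at SDP degree `d = 8`).

Continuation of `ThreePointKernelDimFour` (`Q 4 k` for `k ≤ 6`): two more steps of the homogenised Legendre recurrence
`(k+1) P_{k+1} = (2k+1) x P_k - k w P_{k-1}` (`x = t - uv`, `w = (1-u²)(1-v²)`, `gegenbauerHom_rec` with parameter `1/2`):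
`Q 4 7 = (429x⁷ - 693x⁵w + 315x³w² - 35xw³)/16` and `Q 4 8 = (6435x⁸ - 12012x⁶w + 6930x⁴w² - 1260x²w³ + 35w⁴)/128`.
Needed for exact three-point energy certificates of SDP degree `d = 8` on `S³` (nine matrix blocks `F_0 … F_8`), e.g. the
two-orthogonal-pentagons configuration for the potential `(1+t)^6` (Cohn–Woo 2012 §5.3: sharp at `d = 8`, not at `d = 6`).
-/

noncomputable section

namespace Summit.Ventures.PackingBounds.Energy.QFour

open Literature.Geometry.DiscreteGeometry.BachocVallentin Literature.Analysis.SpecialFunctions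

/-- `Q 4 7 = (429x⁷ - 693x⁵w + 315x³w² - 35xw³)/16`, `x = t - uv`, `w = (1-u²)(1-v²)`. -/
theorem Q4_seven (u v t : ℝ) :
    Q 4 7 u v t = (429 * (t - u * v) ^ 7 - 693 * (t - u * v) ^ 5 * ((1 - u ^ 2) * (1 - v ^ 2))
      + 315 * (t - u * v) ^ 3 * ((1 - u ^ 2) * (1 - v ^ 2)) ^ 2 - 35 * (t - u * v) * ((1 - u ^ 2) * (1 - v ^ 2)) ^ 3) / 16 := by
  have hq0 := Q4_five u v t
  have hq1 := Q4_six u v t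
  have h := gegenbauerHom_rec ((((4 : ℕ) : ℝ) - 3) / 2) (2 * (t - u * v)) ((1 - u ^ 2) * (1 - v ^ 2)) 5
  unfold Q at hq0 hq1 ⊢
  simp only [smul_eq_mul, Nat.cast_ofNat, Nat.reduceAdd] at h
  push_cast at h hq0 hq1 ⊢
  linear_combination (1 / 7 : ℝ) * h + (13 / 7 : ℝ) * (t - u * v) * hq1
    - (6 / 7 : ℝ) * ((1 - u ^ 2) * (1 - v ^ 2)) * hq0

/-- `Q 4 8 = (6435x⁸ - 12012x⁶w + 6930x⁴w² - 1260x²w³ + 35w⁴)/128`, `x = t - uv`, `w = (1-u²)(1-v²)`. -/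
theorem Q4_eight (u v t : ℝ) :
    Q 4 8 u v t = (6435 * (t - u * v) ^ 8 - 12012 * (t - u * v) ^ 6 * ((1 - u ^ 2) * (1 - v ^ 2))
      + 6930 * (t - u * v) ^ 4 * ((1 - u ^ 2) * (1 - v ^ 2)) ^ 2 - 1260 * (t - u * v) ^ 2 * ((1 - u ^ 2) * (1 - v ^ 2)) ^ 3
      + 35 * ((1 - u ^ 2) * (1 - v ^ 2)) ^ 4) / 128 := by
  have hq0 := Q4_six u v t
  have hq1 := Q4_seven u v t
  have h := gegenbauerHom_rec ((((4 : ℕ) : ℝ) - 3) / 2) (2 * (t - u * v)) ((1 - u ^ 2) * (1 - v ^ 2)) 6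
  unfold Q at hq0 hq1 ⊢
  simp only [smul_eq_mul, Nat.cast_ofNat, Nat.reduceAdd] at h
  push_cast at h hq0 hq1 ⊢
  linear_combination (1 / 8 : ℝ) * h + (15 / 8 : ℝ) * (t - u * v) * hq1
    - (7 / 8 : ℝ) * ((1 - u ^ 2) * (1 - v ^ 2)) * hq0

/-- Pole check (`u = v`, `t = 1`): `Q 4 7 u u 1 = (1-u²)^7`, `Q 4 8 u u 1 = (1-u²)^8` (Legendre normalisation `P_k(1) = 1`). -/
theorem Q4_pole_high (u : ℝ) : Q 4 7 u u 1 = (1 - u ^ 2) ^ 7 ∧ Q 4 8 u u 1 = (1 - u ^ 2) ^ 8 := by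
  refine ⟨?_, ?_⟩
  · rw [Q4_seven]; ring
  · rw [Q4_eight]; ring

end Summit.Ventures.PackingBounds.Energy.QFour
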